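import Summits.NavierStokesRegularity.NavierStokesRegularity.Theorems.WakeRatchetEternalViscousRateCircuitPumpTodaWitness

/-!
# The seeded graded Toda perpetual pump AT EVERY PRESCRIBED SCALE RATIO `lam ∈ (1, 3/2]`
# (re-export for `WakeRatchet.EternalViscousRate`, stmt-NavierStokesRegularity-25647; companion of `…CircuitPumpTodaWitness`)

`PerpetualPumpCircuitPump.todaPump_exists` (…CircuitPumpTodaWitness, p827286) supplies, for every `lam₀ > 1`, SOME `lam ∈ (1, lam₀)`
carrying the m = 2 seeded graded Toda pump (`SolvesODE lam T^{opt}_ε X`, exactly self-similar with period 1, Type I, non-trivial).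
The «some» is an artefact of the crux statement `PerpetualPump.CircuitPump`: the tree's clock box `toda_clockBox_eps`, window
`toda_clockBox_window`, bootstrap `toda_boot`, INTO `toda_into` and COVER `toda_cover` are all stated at a GIVEN `lam ∈ (1, 3/2]`, and
the only use of `lam₀` in `stub_clockBox` / `toda_clockBox_explicit` is the choice `lam := min((1+lam₀)/2, 3/2)`.  Re-running the
same proofs with `lam` prescribed:

* `toda_clockBox_at` — the clock box at every `lam ∈ (1, 3/2]` (proof verbatim = `toda_clockBox_explicit` minus the choice of `lam`);
* `todaPump_at` — **the perpetual pump at EVERY `lam ∈ (1, 3/2]`** (pipeline C1 `stub_truncatedFlow` + C2 `stub_clampCovering` →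
  D `stub_truncationLimit` → E `stub_dssExtension`, verbatim = `todaPump_exists`).

Used by `…CircuitPumpEveryScale` to show that the inner statement of ⟨25647⟩ fails at EVERY scale ratio `ε₀ ∈ (0, (3/2)^{2/5} − 1]`.
HONEST LABEL: MODEL lattice ODEs only (Tao 2016 §4); a statement-level re-export of the tree's construction (stmt-1834, PROVED); nothing
here bears on the Navier–Stokes equations and no WakeRatchet item is settled.
-/

set_option linter.dupNamespace false

noncomputable section

open Set

namespace Summit.NavierStokesRegularity.NavierStokesRegularity.Theorems.PerpetualPumpCircuitPump

open Summit.NavierStokesRegularity.NavierStokesRegularity.Theorems.CircuitPumpNegative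

/-- **The clock box of the seeded graded Toda pump AT EVERY PRESCRIBED `lam ∈ (1, 3/2]`** (instance data exposed: `m = 2`, table
`T^{opt}_ε`, seed `0 < ε ≤ 10⁻⁵`): the statement of `toda_clockBox_explicit` with `∀ lam₀ > 1, ∃ lam ∈ (1, lam₀), …` replaced by
`∀ lam ∈ (1, 3/2], …`; proof verbatim (the tree's `toda_clockBox_eps` / `toda_clockBox_window` / `toda_boot` / `toda_into` /
`toda_cover` are all stated at a given `lam ∈ (1, 3/2]`).
[cite: Tao2016AveragedNS, §4 (4.1)–(4.3); cell construction (`PerpetualPump.CircuitPump`, line singular-clock-gspt, stub A)] -/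
theorem toda_clockBox_at :
    ∀ lam : ℝ, 1 < lam → lam ≤ 3 / 2 →
    ∃ ε : ℝ, 0 < ε ∧ ε ≤ 1 / 100000 ∧
      ∃ (lo hi : Fin 2 → ℝ) (Q : ℤ → Set (Fin 2 → ℝ)) (ia ip : Fin 2) (T₁ T₂ : ℝ → ℝ)
        (C Tmin Tmax : ℝ) (L₀ : ℕ),
        ia ≠ ip ∧ 1 ≤ L₀ ∧
        ((∀ i : Fin 2, lo i ≤ hi i) ∧
          (∀ n : ℤ, n ≠ 0 → IsCompact (Q n) ∧ Convex ℝ (Q n) ∧ (Q n).Nonempty) ∧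
          (∀ n : ℤ, (L₀ : ℤ) < |n| → (fun _ : Fin 2 => (0 : ℝ)) ∈ Q n)) ∧
        0 < lo ia ∧
        (ContinuousOn T₁ (Set.Icc (lo ia) (hi ia)) ∧ ContinuousOn T₂ (Set.Icc (lo ia) (hi ia)) ∧ 0 < Tmin ∧
          ∀ A ∈ Set.Icc (lo ia) (hi ia), Tmin ≤ T₁ A ∧ T₁ A ≤ T₂ A ∧ T₂ A ≤ Tmax) ∧
        ∀ L : ℕ, L₀ ≤ L →
          ∀ x : Fin 2 → ℤ → ℝ,
            ((∀ i : Fin 2, lo i ≤ x i 0 ∧ x i 0 ≤ hi i) ∧ ∀ n : ℤ, n ≠ 0 → (fun i => x i n) ∈ Q n) →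
            (∀ (i : Fin 2) (n : ℤ), (L : ℤ) < |n| → x i n = 0) →
            (∀ (T' : ℝ) (Z : Fin 2 → ℤ → ℝ → ℝ), 0 < T' → T' ≤ Tmax →
                ((∀ (i : Fin 2) (n : ℤ), Z i n 0 = x i n) ∧
                  (∀ (i : Fin 2) (n : ℤ), (L : ℤ) < |n| → ∀ t ∈ Set.Icc (0 : ℝ) T', Z i n t = 0) ∧
                  (∀ (i : Fin 2) (n : ℤ), |n| ≤ (L : ℤ) → ∀ t ∈ Set.Icc (0 : ℝ) T',
                    HasDerivWithinAt (Z i n)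
                      (Summit.NavierStokesRegularity.NavierStokesRegularity.Theorems.CircuitPumpNegative.rhsF
                        lam (fun (i₁ i₂ i₃ : Fin 2) (μ : Option (Fin 3)) => if μ = none then (if i₁ = 1 ∧ i₂ = 1 ∧ i₃ = 0
                              then (-1 : ℝ) else if i₁ = 1 ∧ i₂ = 0 ∧ i₃ = 1 then 1 / 2 else if i₁ = 0 ∧ i₂ = 1 ∧ i₃ = 1
                              then 1 / 2 else if i₁ = 0 ∧ i₂ = 0 ∧ i₃ = 1 then ε else if i₁ = 0 ∧ i₂ = 1 ∧ i₃ = 0 then -ε /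
                              2 else if i₁ = 1 ∧ i₂ = 0 ∧ i₃ = 0 then -ε / 2 else 0) else if μ = some 2 then (if i₁ = 1 ∧
                              i₂ = 1 ∧ i₃ = 0 then 1 else 0) else if μ = some 1 then (if i₁ = 1 ∧ i₂ = 0 ∧ i₃ = 1 then -1 /
                              2 else 0) else (if i₁ = 0 ∧ i₂ = 1 ∧ i₃ = 1 then -1 / 2 else 0)) Z i n t) (Set.Icc (0 : ℝ) T') t)) →
                ∀ (i : Fin 2) (n : ℤ), ∀ t ∈ Set.Icc (0 : ℝ) T', lam ^ ((3 / 5 : ℝ) * n) * |Z i n t| ≤ C) ∧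
            (∀ Z : Fin 2 → ℤ → ℝ → ℝ,
              ((∀ (i : Fin 2) (n : ℤ), Z i n 0 = x i n) ∧
                (∀ (i : Fin 2) (n : ℤ), (L : ℤ) < |n| → ∀ t ∈ Set.Icc (0 : ℝ) Tmax, Z i n t = 0) ∧
                (∀ (i : Fin 2) (n : ℤ), |n| ≤ (L : ℤ) → ∀ t ∈ Set.Icc (0 : ℝ) Tmax,
                  HasDerivWithinAt (Z i n)
                    (Summit.NavierStokesRegularity.NavierStokesRegularity.Theorems.CircuitPumpNegative.rhsF
                      lam (fun (i₁ i₂ i₃ : Fin 2) (μ : Option (Fin 3)) => if μ = none then (if i₁ = 1 ∧ i₂ = 1 ∧ i₃ = 0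
                            then (-1 : ℝ) else if i₁ = 1 ∧ i₂ = 0 ∧ i₃ = 1 then 1 / 2 else if i₁ = 0 ∧ i₂ = 1 ∧ i₃ = 1
                            then 1 / 2 else if i₁ = 0 ∧ i₂ = 0 ∧ i₃ = 1 then ε else if i₁ = 0 ∧ i₂ = 1 ∧ i₃ = 0 then -ε /
                            2 else if i₁ = 1 ∧ i₂ = 0 ∧ i₃ = 0 then -ε / 2 else 0) else if μ = some 2 then (if i₁ = 1 ∧
                            i₂ = 1 ∧ i₃ = 0 then 1 else 0) else if μ = some 1 then (if i₁ = 1 ∧ i₂ = 0 ∧ i₃ = 1 then -1 /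
                            2 else 0) else (if i₁ = 0 ∧ i₂ = 1 ∧ i₃ = 1 then -1 / 2 else 0)) Z i n t) (Set.Icc (0 : ℝ) Tmax) t)) →
              (∀ T ∈ Set.Icc (T₁ (x ia 0)) (T₂ (x ia 0)),
                  (∀ n : ℤ, n ≠ 0 → |n| ≤ (L : ℤ) →
                    (fun i => lam ^ (1 / 5 : ℝ) * Z i (n + 1) T) ∈ Q n) ∧
                  (∀ i : Fin 2, i ≠ ia → i ≠ ip →
                    lo i ≤ lam ^ (1 / 5 : ℝ) * Z i 1 T ∧ lam ^ (1 / 5 : ℝ) * Z i 1 T ≤ hi i)) ∧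
              (∀ T ∈ Set.Icc (T₁ (x ia 0)) (T₂ (x ia 0)), lam ^ (1 / 5 : ℝ) * Z ip 1 T = x ip 0 →
                  (x ia 0 = lo ia → lam ^ (1 / 5 : ℝ) * Z ia 1 T < lo ia) ∧
                  (x ia 0 = hi ia → hi ia < lam ^ (1 / 5 : ℝ) * Z ia 1 T)) ∧
              (lam ^ (1 / 5 : ℝ) * Z ip 1 (T₁ (x ia 0)) < x ip 0 ∧
                x ip 0 < lam ^ (1 / 5 : ℝ) * Z ip 1 (T₂ (x ia 0)))) := by
  intro lam hlam1 hlam32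
  obtain ⟨ν, q, r, ε, Λ, As, A₁, A₂, Tmax, hν, hq, hr, hε, hΛ, hAs, hA₁, hA₂, h4, hbig, hTmax, hε5, hs2,
    hs3, hs5, hsσ, hs6, hs7⟩ := toda_clockBox_eps lam hlam1 hlam32
  subst hν hq hr hΛ
  have hwin := toda_clockBox_window lam (lam ^ (4 / 5 : ℝ)) (lam ^ (1 / 5 : ℝ)) ε (-Real.log ε) As A₁ A₂
    hlam1 hlam32 rfl rfl hε rfl hAs hA₁ hA₂ h4 hbig
  rw [← hTmax] at hwin
  obtain ⟨⟨hc1, hc2⟩, hTmin, hT8, hchain, hpt⟩ := hwin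
  have hAs0 : 0 < As := by have h := h4; rw [hA₁] at h; linarith
  have hA₁0 : 0 < A₁ := by linarith
  have hA12 : A₁ ≤ A₂ := by rw [hA₁, hA₂]; linarith
  have hTmax0 : 0 < Tmax := by
    have h := hchain A₁ ⟨le_rfl, hA12⟩
    linarith [h.1, h.2.1, h.2.2]
  refine ⟨ε, hε, hε5,
    (fun i : Fin 2 => if i = 0 then A₁ else Real.sqrt ε), (fun i : Fin 2 => if i = 0 then A₂ else Real.sqrt ε),
    (fun n : ℤ => if n < 0 then {y : Fin 2 → ℝ | -(13 * lam ^ (-(n : ℝ) / 5) * (2 - lam ^ ((4 / 5 : ℝ) * n))) ≤ y 0 ∧ y 0 ≤ 13 * lam ^ (-(n : ℝ) / 5) * (2 - lam ^ ((4 / 5 : ℝ) * n)) ∧ 0 ≤ y 1 ∧ y 1 ≤ 40 / A₁ * lam ^ (-(n : ℝ) / 5) * Real.exp ((65 + 169 / 10 * ε * A₁) * Tmax * (1 - lam ^ ((4 / 5 : ℝ) * (n + 1))) / (1 - lam ^ (-(4 / 5 : ℝ))))}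
      else if n = 1 then {y : Fin 2 → ℝ | -ε ^ 2 ≤ y 0 ∧ y 0 ≤ ε ^ (3 / 4 : ℝ) ∧ 0 ≤ y 1 ∧ y 1 ≤ ε ^ (3 / 2 : ℝ)}
      else {y : Fin 2 → ℝ | -(ε ^ 2 * (2 * lam) ^ (-(n : ℝ))) ≤ y 0 ∧ y 0 ≤ ε ^ 2 * (2 * lam) ^ (-(n : ℝ)) ∧ 0 ≤ y 1 ∧
        y 1 ≤ ε ^ (3 / 2 : ℝ) * (2 * lam) ^ (-(n : ℝ))}),
    0, 1, (fun A : ℝ => (((-Real.log (1 - (((-Real.log ε) / 2 + Real.log (A / 8)) + 11 / 5) / A)) + (250 + 16 * Real.log A) / A) + (-(1 / lam ^ (4 / 5 : ℝ)) * Real.log (1 - lam ^ (4 / 5 : ℝ) * ((-Real.log ε) / 2 - Real.log (lam ^ (1 / 5 : ℝ)) - 28 * Real.log A - 449) / (lam * (A - ((-Real.log ε) / 2 + Real.log (A / 8)) + 903 + 50 * Real.log A)))))), (fun A : ℝ => (((-Real.log (1 - (((-Real.log ε) / 2 + Real.log (A / 8)) + 11 / 5) / A)) + (250 + 16 * Real.log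 A) / A) + (-(1 / lam ^ (4 / 5 : ℝ)) * Real.log (1 - lam ^ (4 / 5 : ℝ) * ((-Real.log ε) / 2 - Real.log (lam ^ (1 / 5 : ℝ)) + 73) / (lam * (A - ((-Real.log ε) / 2 + Real.log (A / 8)) - 903 - 50 * Real.log A)))))),
    lam ^ (3 / 5 : ℝ) * (A₂ + 3) + 30, 250 / A₂, Tmax, 2, by decide, by norm_num, ?_, ?_, ?_, ?_⟩
  · -- BoxOK
    refine ⟨?_, fun n _ => (clockBox_boxes lam (lam ^ (-(4 / 5 : ℝ))) ε A₁ Tmax hlam1 hε hA₁0 n).1,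
      fun n _ => (clockBox_boxes lam (lam ^ (-(4 / 5 : ℝ))) ε A₁ Tmax hlam1 hε hA₁0 n).2⟩
    intro i
    rcases fin_two_eq_zero_or_one i with rfl | rfl
    · show A₁ ≤ A₂
      exact hA12
    · show Real.sqrt ε ≤ Real.sqrt ε
      exact le_rfl
  · -- 0 < lo ia
    show 0 < A₁
    exact hA₁0
  · -- WindowOK
    show ContinuousOn (fun A : ℝ => (((-Real.log (1 - (((-Real.log ε) / 2 + Real.log (A / 8)) + 11 / 5) / A)) + (250 + 16 * Real.log A) / A) + (-(1 / lam ^ (4 / 5 : ℝ)) * Real.log (1 - lam ^ (4 / 5 : ℝ) * ((-Real.log ε) / 2 - Real.log (lam ^ (1 / 5 : ℝ)) - 28 * Real.log A - 449) / (lam * (A - ((-Real.log ε) / 2 + Real.log (A / 8)) + 903 + 50 * Real.log A)))))) (Set.Icc A₁ A₂) ∧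
      ContinuousOn (fun A : ℝ => (((-Real.log (1 - (((-Real.log ε) / 2 + Real.log (A / 8)) + 11 / 5) / A)) + (250 + 16 * Real.log A) / A) + (-(1 / lam ^ (4 / 5 : ℝ)) * Real.log (1 - lam ^ (4 / 5 : ℝ) * ((-Real.log ε) / 2 - Real.log (lam ^ (1 / 5 : ℝ)) + 73) / (lam * (A - ((-Real.log ε) / 2 + Real.log (A / 8)) - 903 - 50 * Real.log A)))))) (Set.Icc A₁ A₂) ∧ 0 < 250 / A₂ ∧
      ∀ A ∈ Set.Icc A₁ A₂, 250 / A₂ ≤ (((-Real.log (1 - (((-Real.log ε) / 2 + Real.log (A / 8)) + 11 / 5) / A)) + (250 + 16 * Real.log A) / A) + (-(1 / lam ^ (4 / 5 : ℝ)) * Real.log (1 - lam ^ (4 / 5 : ℝ) * ((-Real.log ε) / 2 - Real.log (lam ^ (1 / 5 : ℝ)) - 28 * Real.log A - 449) / (lam * (A - ((-Real.log ε) / 2 + Real.log (A / 8)) + 903 + 50 * Real.log A))))) ∧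
        (((-Real.log (1 - (((-Real.log ε) / 2 + Real.log (A / 8)) + 11 / 5) / A)) + (250 + 16 * Real.log A) / A) + (-(1 / lam ^ (4 / 5 : ℝ)) * Real.log (1 - lam ^ (4 / 5 : ℝ) * ((-Real.log ε) / 2 - Real.log (lam ^ (1 / 5 : ℝ)) - 28 * Real.log A - 449) / (lam * (A - ((-Real.log ε) / 2 + Real.log (A / 8)) + 903 + 50 * Real.log A))))) ≤ (((-Real.log (1 - (((-Real.log ε) / 2 + Real.log (A / 8)) + 11 / 5) / A)) + (250 + 16 * Real.log A) / A) + (-(1 / lam ^ (4 / 5 : ℝ)) * Real.log (1 - lam ^ (4 / 5 : ℝ) * ((-Real.log ε) / 2 - Real.log (lam ^ (1 / 5 : ℝ)) + 73) / (lam * (A - ((-Real.log ε) / 2 + Real.log (A / 8)) - 903 - 50 * Real.log A))))) ∧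
        (((-Real.log (1 - (((-Real.log ε) / 2 + Real.log (A / 8)) + 11 / 5) / A)) + (250 + 16 * Real.log A) / A) + (-(1 / lam ^ (4 / 5 : ℝ)) * Real.log (1 - lam ^ (4 / 5 : ℝ) * ((-Real.log ε) / 2 - Real.log (lam ^ (1 / 5 : ℝ)) + 73) / (lam * (A - ((-Real.log ε) / 2 + Real.log (A / 8)) - 903 - 50 * Real.log A))))) ≤ Tmax
    exact ⟨hc1, hc2, hTmin, hchain⟩
  · -- CoveringHyp
    intro L hL x hx _htr
    obtain ⟨hbox0, hboxQ⟩ := hx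
    refine ⟨?_, ?_⟩
    · -- (0) a-priori bound
      intro T' Z hT' hT'le hZ
      obtain ⟨hinit, hzero, hode⟩ := hZ
      obtain ⟨hz', hcont', hder'⟩ := clockBox_sol ε lam T' L Z _ rfl hzero hode
      obtain ⟨-, d0, d1, d2, d3, d4, d5, d6, d7, d8, d9, d10⟩ := clockBox_data lam (lam ^ (-(4 / 5 : ℝ))) ε A₁ A₂ Tmax x Z hbox0 hboxQ hinit
      have hB := toda_boot lam (lam ^ (4 / 5 : ℝ)) (lam ^ (1 / 5 : ℝ)) (lam ^ (-(4 / 5 : ℝ))) ε (-Real.log ε) As A₁ A₂ Tmax hlam1 hlam32 rfl rfl rfl hε rfl hAs hA₁ hA₂ h4 hbig hTmax hε5 hs2 hs3 hs5 hsσ hs6 hs7 L (x 0 0) T' (Z 0) (Z 1) hL hT' hT'le d0 d1 d2 d3 d4 d5 d6 d7 d8 d9 d10 hz' hcont' hder'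
      intro i n t ht
      obtain ⟨-, -, -, hw⟩ := hB t ht
      rcases fin_two_eq_zero_or_one i with rfl | rfl
      · exact (hw n).1
      · exact (hw n).2
    · -- INTO / COVER / PHASE
      intro Z hZ
      obtain ⟨hinit, hzero, hode⟩ := hZ
      obtain ⟨hz', hcont', hder'⟩ := clockBox_sol ε lam Tmax L Z _ rfl hzero hode
      obtain ⟨hx1, d0, d1, d2, d3, d4, d5, d6, d7, d8, d9, d10⟩ := clockBox_data lam (lam ^ (-(4 / 5 : ℝ))) ε A₁ A₂ Tmax x Z hbox0 hboxQ hinit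
      have hB := toda_boot lam (lam ^ (4 / 5 : ℝ)) (lam ^ (1 / 5 : ℝ)) (lam ^ (-(4 / 5 : ℝ))) ε (-Real.log ε) As A₁ A₂ Tmax hlam1 hlam32 rfl rfl rfl hε rfl hAs hA₁ hA₂ h4 hbig hTmax hε5 hs2 hs3 hs5 hsσ hs6 hs7 L (x 0 0) Tmax (Z 0) (Z 1) hL hTmax0 le_rfl d0 d1 d2 d3 d4 d5 d6 d7 d8 d9 d10 hz' hcont' hder'
      have hcorr : ∀ t ∈ Set.Icc 0 Tmax, Z 1 1 t ≤ 1 / 4 ∧ Z 1 (-1) t ≤ 1 ∧ |Z 0 2 t| ≤ 1 :=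
        fun t ht => ⟨(hB t ht).1, (hB t ht).2.1, (hB t ht).2.2.1⟩
      have hA : x 0 0 ∈ Set.Icc A₁ A₂ := ⟨d1, d2⟩
      obtain ⟨hA4, hΛA, hεA, hsqA, -, -, hDm, -⟩ := hpt (x 0 0) hA
      obtain ⟨cu, cv, cw, cz, ce, cy, ou, ov, ow, oz⟩ :=
        toda_boot_sys lam (lam ^ (4 / 5 : ℝ)) ε Tmax L (Z 0) (Z 1) rfl hL hcont' hder'
      have hbnn := (toda_trunc_structure lam ε Tmax L (Z 0) (Z 1) (by linarith) hε.le hTmax0 hz' hcont'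
        hder' d8).1
      have ht3 : ((-Real.log (1 - (((-Real.log ε) / 2 + Real.log ((x 0 0) / 8)) + 11 / 5) / (x 0 0))) + (250 + 16 * Real.log (x 0 0)) / (x 0 0)) ≤ Tmax := by
        have h := hchain (x 0 0) hA
        linarith [h.2.1, h.2.2, hDm]
      have hzs := toda_active_zsup lam (lam ^ (4 / 5 : ℝ)) ε (x 0 0) Tmax (Z 0 0) (Z 1 0) (Z 0 1) (Z 1 1)
        (Z 1 (-1)) (Z 0 2) hlam1 hlam32 rfl hε hTmax0 (by linarith) hA4 hΛA hεA hsqA ht3 d0 d3 d4 d5 d6 d7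
        cu cv cw cz ce cy ou ov ow oz (fun t ht => ⟨hbnn (-1) t ht, (hcorr t ht).2.1⟩)
        (fun t ht => (hcorr t ht).2.2) (fun t ht => by linarith [(hcorr t ht).1])
      have hI := toda_into lam (lam ^ (4 / 5 : ℝ)) (lam ^ (1 / 5 : ℝ)) (lam ^ (-(4 / 5 : ℝ))) ε (-Real.log ε) As A₁ A₂ Tmax hlam1 hlam32 rfl rfl rfl hε rfl hAs hA₁ hA₂ h4 hbig hTmax hε5 hs2 hs3 hs5 hsσ hs6 hs7 L (x 0 0) (Z 0) (Z 1) hL d0 d1 d2 d3 d4 d5 d6 d7 d8 d9 d10 hz' hcont' hder' hcorr hzs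
      have hC := toda_cover lam (lam ^ (4 / 5 : ℝ)) (lam ^ (1 / 5 : ℝ)) (lam ^ (-(4 / 5 : ℝ))) ε (-Real.log ε) As A₁ A₂ Tmax hlam1 hlam32 rfl rfl rfl hε rfl hAs hA₁ hA₂ h4 hbig hTmax hε5 L (x 0 0) (Z 0) (Z 1) hL d0 d1 d2 d3 d4 d5 d6 d7 d8 d9 d10 hz' hcont' hder' hcorr hzs
      refine ⟨fun T hT => ⟨fun n hn0 hnL => ?_, fun i hi0 hi1 => ?_⟩, ?_, ?_⟩
      · -- INTO
        obtain ⟨htr, h2, hpr⟩ := hI T hT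
        rcases lt_trichotomy n 0 with hn | rfl | hn
        · obtain ⟨ha, hb0, hb1⟩ := htr n (by omega) (by have := abs_le.1 hnL; omega)
          simp only [hn, ↓reduceIte, Set.mem_setOf_eq]
          exact ⟨(abs_le.1 ha).1, (abs_le.1 ha).2, hb0, hb1⟩
        · exact absurd rfl hn0
        · by_cases hn1 : n = 1
          · subst hn1
            simp only [show ¬ ((1 : ℤ) < 0) from by norm_num, ↓reduceIte, Set.mem_setOf_eq, Int.reduceAdd]
            exact h2
          · obtain ⟨ha, hb0, hb1⟩ := hpr n (by omega) (by have := abs_le.1 hnL; omega)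
            simp only [show ¬ (n < 0) from by omega, hn1, ↓reduceIte, Set.mem_setOf_eq]
            exact ⟨by linarith [(abs_le.1 ha).1], (abs_le.1 ha).2, hb0, hb1⟩
      · -- no third species
        rcases fin_two_eq_zero_or_one i with h | h
        · exact absurd h hi0
        · exact absurd h hi1
      · -- COVER
        intro T hT hph
        show (x 0 0 = A₁ → lam ^ (1 / 5 : ℝ) * Z 0 1 T < A₁) ∧ (x 0 0 = A₂ → A₂ < lam ^ (1 / 5 : ℝ) * Z 0 1 T)
        rw [hx1] at hph
        exact hC.1 T hT hph
      · -- PHASE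
        rw [hx1]
        exact hC.2


/-- **The seeded graded Toda perpetual pump AT EVERY PRESCRIBED SCALE RATIO `lam ∈ (1, 3/2]`, with its table**: a seed
`ε ∈ (0, 10⁻⁵]` and a solution `X : Fin 2 → ℤ → ℝ → ℝ` of the m = 2 seeded graded Toda circuit on `(-∞,0)` (`SolvesODE lam T^{opt}_ε X`)
that is exactly self-similar with period 1, Type I and non-trivial.  Pipeline verbatim = `todaPump_exists` (C1 `stub_truncatedFlow` +
C2 `stub_clampCovering` → D `stub_truncationLimit` → E `stub_dssExtension`) over `toda_clockBox_at`.
[cite: Tao2016AveragedNS, §4 (4.1)–(4.3), Thm. 4.2 (statement shape); cell construction (`PerpetualPump.CircuitPump`, stmt-NavierStokesRegularity-1834)] -/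
theorem todaPump_at :
    ∀ lam : ℝ, 1 < lam → lam ≤ 3 / 2 → ∃ ε : ℝ, 0 < ε ∧ ε ≤ 1 / 100000 ∧
      ∃ X : Fin 2 → ℤ → ℝ → ℝ,
        Summit.NavierStokesRegularity.NavierStokesRegularity.Theorems.CircuitPumpNegative.SolvesODE lam
          (fun (i₁ i₂ i₃ : Fin 2) (μ : Option (Fin 3)) => if μ = none then (if i₁ = 1 ∧ i₂ = 1 ∧ i₃ = 0
                then (-1 : ℝ) else if i₁ = 1 ∧ i₂ = 0 ∧ i₃ = 1 then 1 / 2 else if i₁ = 0 ∧ i₂ = 1 ∧ i₃ = 1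
                then 1 / 2 else if i₁ = 0 ∧ i₂ = 0 ∧ i₃ = 1 then ε else if i₁ = 0 ∧ i₂ = 1 ∧ i₃ = 0 then -ε /
                2 else if i₁ = 1 ∧ i₂ = 0 ∧ i₃ = 0 then -ε / 2 else 0) else if μ = some 2 then (if i₁ = 1 ∧
                i₂ = 1 ∧ i₃ = 0 then 1 else 0) else if μ = some 1 then (if i₁ = 1 ∧ i₂ = 0 ∧ i₃ = 1 then -1 /
                2 else 0) else (if i₁ = 0 ∧ i₂ = 1 ∧ i₃ = 1 then -1 / 2 else 0)) X ∧
        Summit.NavierStokesRegularity.NavierStokesRegularity.Theorems.CircuitPumpNegative.IsDSS lam 1 X ∧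
        Summit.NavierStokesRegularity.NavierStokesRegularity.Theorems.CircuitPumpNegative.IsTypeI lam X ∧
        Summit.NavierStokesRegularity.NavierStokesRegularity.Theorems.CircuitPumpNegative.IsNontrivial X := by
  intro lam hlam hlam32
  obtain ⟨ε, hε, hε5, lo, hi, Q, ia, ip, T₁, T₂, C, Tmin, Tmax, L₀, hip, hL₀, hbox,
    hpos, hwin, hcov⟩ := toda_clockBox_at lam hlam hlam32
  obtain ⟨hT₁c, hT₂c, hTmin, hwinA⟩ := hwin
  have hAmem : lo ia ∈ Icc (lo ia) (hi ia) := ⟨le_rfl, hbox.1 ia⟩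
  have hTT : Tmin ≤ Tmax := by
    obtain ⟨h1, h2, h3⟩ := hwinA _ hAmem
    linarith
  have hTmax : 0 < Tmax := lt_of_lt_of_le hTmin hTT
  have hQ : ∀ n : ℤ, n ≠ 0 → IsCompact (Q n) := fun n hn => (hbox.2.1 n hn).1
  -- relative periodic points of the truncated lattices at every level (C1 + C2), then the limit (D)
  obtain ⟨T, Z, hTmem, hsol, hwb, hin, hmatch⟩ :=
    stub_truncationLimit lam hlam 2 (fun (i₁ i₂ i₃ : Fin 2) (μ : Option (Fin 3)) => if μ = none then (if i₁ = 1 ∧ i₂ = 1 ∧ i₃ = 0 then (-1 : ℝ) else if i₁ = 1 ∧ i₂ = 0 ∧ i₃ = 1 then 1 / 2 else if i₁ = 0 ∧ i₂ = 1 ∧ i₃ = 1 then 1 / 2 else if i₁ = 0 ∧ i₂ = 0 ∧ i₃ = 1 then ε else if i₁ = 0 ∧ i₂ = 1 ∧ i₃ = 0 then -ε / 2 else if i₁ = 1 ∧ i₂ = 0 ∧ i₃ = 0 then -ε / 2 else 0) else if μ = some 2 then (if i₁ = 1 ∧ i₂ = 1 ∧ i₃ = 0 then 1 else 0) else if μ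 = some 1 then (if i₁ = 1 ∧ i₂ = 0 ∧ i₃ = 1 then -1 / 2 else 0) else (if i₁ = 0 ∧ i₂ = 1 ∧ i₃ = 1 then -1 / 2 else 0)) lo hi Q C Tmin Tmax hTmin hTT hQ (by
      intro L'
      refine ⟨max L' L₀, le_max_left _ _, ?_⟩
      have hL : L₀ ≤ max L' L₀ := le_max_right _ _
      obtain ⟨Φ, hflow, hcont⟩ := stub_truncatedFlow lam hlam 2 (fun (i₁ i₂ i₃ : Fin 2) (μ : Option (Fin 3)) => if μ = none then (if i₁ = 1 ∧ i₂ = 1 ∧ i₃ = 0 then (-1 : ℝ) else if i₁ = 1 ∧ i₂ = 0 ∧ i₃ = 1 then 1 / 2 else if i₁ = 0 ∧ i₂ = 1 ∧ i₃ = 1 then 1 / 2 else if i₁ = 0 ∧ i₂ = 0 ∧ i₃ = 1 then ε else if i₁ = 0 ∧ i₂ = 1 ∧ i₃ = 0 then -ε / 2 else if i₁ = 1 ∧ i₂ = 0 ∧ i₃ = 0 then -ε / 2 else 0) else if μ = some 2 then (if i₁ = 1 ∧ i₂ = 1 ∧ i₃ = 0 then 1 else 0) else if μ = some 1 then (if i₁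 = 1 ∧ i₂ = 0 ∧ i₃ = 1 then -1 / 2 else 0) else (if i₁ = 0 ∧ i₂ = 1 ∧ i₃ = 1 then -1 / 2 else 0)) (max L' L₀) Tmax C
        {x | ((∀ i : Fin 2, lo i ≤ x i 0 ∧ x i 0 ≤ hi i) ∧ ∀ n : ℤ, n ≠ 0 → (fun i => x i n) ∈ Q n) ∧
          ∀ (i : Fin 2) (n : ℤ), ((max L' L₀ : ℕ) : ℤ) < |n| → x i n = 0}
        hTmax (fun x hx => hx.2)
        (fun x hx T' Z' hT' hle hZ' => (hcov _ hL x hx.1 hx.2).1 T' Z' hT' hle hZ')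
      obtain ⟨x, T, Z, hxin, -, hTmem, hsolZ, hwbZ, hmatchZ⟩ :=
        stub_clampCovering lam hlam 2 (fun (i₁ i₂ i₃ : Fin 2) (μ : Option (Fin 3)) => if μ = none then (if i₁ = 1 ∧ i₂ = 1 ∧ i₃ = 0 then (-1 : ℝ) else if i₁ = 1 ∧ i₂ = 0 ∧ i₃ = 1 then 1 / 2 else if i₁ = 0 ∧ i₂ = 1 ∧ i₃ = 1 then 1 / 2 else if i₁ = 0 ∧ i₂ = 0 ∧ i₃ = 1 then ε else if i₁ = 0 ∧ i₂ = 1 ∧ i₃ = 0 then -ε / 2 else if i₁ = 1 ∧ i₂ = 0 ∧ i₃ = 0 then -ε / 2 else 0) else if μ = some 2 then (if i₁ = 1 ∧ i₂ = 1 ∧ i₃ = 0 then 1 else 0) else if μ = some 1 then (if i₁ = 1 ∧ i₂ = 0 ∧ i₃ = 1 then -1 / 2 else 0) else (if i₁ = 0 ∧ i₂ = 1 ∧ i₃ = 1 then -1 / 2 else 0)) lo hi Q ia ip T₁ T₂ C Tmin Tmax L₀ (max L' L₀) hip hL₀ hL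
          hbox ⟨hT₁c, hT₂c, hTmin, hwinA⟩ (hcov _ hL) ⟨Φ, fun x hx hv => hflow x ⟨hx, hv⟩, hcont⟩
      obtain ⟨h1, h2, h3⟩ := hwinA _ (hxin.1 ia)
      exact ⟨x, T, Z, hxin, ⟨le_trans h1 hTmem.1, le_trans hTmem.2 h3⟩, hsolZ, hwbZ, hmatchZ⟩)
  -- the one-period witness of the full lattice, unrolled (E)
  have hTpos : 0 < T := lt_of_lt_of_le hTmin hTmem.1
  have hlam0 : 0 < lam := by linarith
  obtain ⟨X, hode, hdss, htI, hnt⟩ := stub_dssExtension lam hlam 2 (fun (i₁ i₂ i₃ : Fin 2) (μ : Option (Fin 3)) => if μ = none then (if i₁ = 1 ∧ i₂ = 1 ∧ i₃ = 0 then (-1 : ℝ) else if i₁ = 1 ∧ i₂ = 0 ∧ i₃ = 1 then 1 / 2 else if i₁ = 0 ∧ i₂ = 1 ∧ i₃ = 1 then 1 / 2 else if i₁ = 0 ∧ i₂ = 0 ∧ i₃ = 1 then ε else if i₁ = 0 ∧ i₂ = 1 ∧ i₃ = 0 then -ε / 2 else if i₁ = 1 ∧ i₂ = 0 ∧ i₃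 = 0 then -ε / 2 else 0) else if μ = some 2 then (if i₁ = 1 ∧ i₂ = 1 ∧ i₃ = 0 then 1 else 0) else if μ = some 1 then (if i₁ = 1 ∧ i₂ = 0 ∧ i₃ = 1 then -1 / 2 else 0) else (if i₁ = 0 ∧ i₂ = 1 ∧ i₃ = 1 then -1 / 2 else 0)) T Z hTpos
    (fun i n t ht => (hsol i n t ⟨ht.1, le_trans ht.2 hTmem.2⟩).mono (Icc_subset_Icc le_rfl hTmem.2))
    (fun i n => by rw [hmatch i n, ← mul_assoc, ← Real.rpow_add hlam0]; norm_num)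
    ⟨C, fun i n t ht => hwb i n t ⟨ht.1, le_trans ht.2 hTmem.2⟩⟩
    ⟨ia, 0, ne_of_gt (lt_of_lt_of_le hpos (hin.1 ia).1)⟩
  exact ⟨ε, hε, hε5, X, hode, hdss, htI, hnt⟩


end Summit.NavierStokesRegularity.NavierStokesRegularity.Theorems.PerpetualPumpCircuitPump

end
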